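import Literature.MathematicalPhysics.QuantumFieldTheory.Balaban1983to89.B4Lemma22EdgesCubeField

/-!
# [B4] LEMMA 2.2's HYPOTHESIS «Ã a regular vector field configuration …, constant in a neighbourhood of the boundary of
# □» FOR A GENERAL FIELD: the Lemma-2.2-lineage field hypotheses, the invertibility/contour package and the threshold
# «for e sufficiently small» for `Ã = A₀ + A′`, `A₀ = Ã(0)`, PROVED from (1.7) and the collar constancy
# [Balaban1983RegularityDecay]

statement-level skeleton of published theorems with citation tags; proofs where landed; nothing here is a claim about the Yang–Mills mass gap

CITATION HEADER.  T. Bałaban, *Regularity and decay of lattice Green's functions*, Commun. Math. Phys. **89** (1983)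
571–597, doi:10.1007/bf01214744 [Balaban1983RegularityDecay] (cell paper B4; held text
`paper:balaban1983-cmp89-regularity-decay`, journal page = PDF page + 570; pp. 573, 575, 577–579, 581; Lemma 2.2 read
from the page renders `…regularity-decay-p007-x2.png`, `…-p008-x2.png`).  PDF held: yes.  Unit `lit-balaban-p35` gen 7
(Phase-2 proof seat), HOME `run/shared/lean/pub/lit-balaban/`.  WHAT IS REPRODUCED: the hypotheses of SKELETON row
**B4.Lem2.2** («Ã … regular … constant in a neighbourhood of the boundary of □», «for e sufficiently small») for a GENERAL
component field — companion of gen 6's `B4CubeFieldHyps22` (the same for the cube configurations `Ã_j` of p. 575) and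
file 1 of 4 of the general-field Lemma 2.2 (`B4Lemma22RegField`, `B4Lemma22RegFieldDual`, `B4Lemma22RegFieldFam`).
Imports gen 7's `B4Lemma22EdgesCubeField` (closure: gen 6's `B4CubeFields22` — `fluct`, `fluct_step`, `fluct_antisymm`,
`abs_fluct_le` —, `B4CubeFieldHyps22` — `cube_threshold`, `smallness_of_le`, charge scalings —, gen 4's
`B4Lemma22Invertible`, `B4Lemma22SupStair.stair_lsum_le`).

WHAT IS PRINTED (pp. 577–579, verbatim).  Lemma 2.2: «… let Ã be a regular vector field configuration in the sense of
Proposition I.2.1, constant in a neighbourhood of the boundary of □. Then for e sufficiently small …»; p. 579 (2.23):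
«A = A₀ + A′, |A′|, |∂^η_μA′| ≤ c′e^{β−1},»; p. 573 (1.7): «|(∂^η_μA)(x)| ≤ ce^{β−1}, x ∈ Ω, μ = 1,…,d, β > 0»; p. 575:
«A′ is regular and small, i.e. |A′|, |∂^η_μA′| ≤ c′e^{β−1}, with c′ depending on c, d, and M, more exactly c′ = dMc».

DICTIONARY (lattice units, as in the lineage: `d + 1` lattice dimensions; box `□ = Π_μ[0, nM_μ)`, `n = L^k`,
`L = ℓ + 1 ≥ 2`, `M_μ ≤ S` unit blocks; `Ã` in component form `Ac : ℤ^{d+1} → (directions → ℝ)`, its bond function on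
`□` being `constBond (Ã(0)) + fluct □ (Ã(0)) Ã` (gen 6's `fluct` = `A′ = Ã − A₀` with `A₀ = Ã(0)`); coupling `e/n`).
* «regular in the sense of Proposition I.2.1» = (1.7) in the b04/p17 reading: `|Ã_ν(x + e_μ) − Ã_ν(x)| ≤ c·e^{β−1}/n` on
  `□`, every pair of directions.
* «constant in a neighbourhood of the boundary of □» = THE COLLAR CONSTANCY: `Ã_ν(x) = Ã_ν(0)` for every `ν` at every
  site of `□` having a coordinate `x_μ = 0` or `x_μ ≥ nM_μ − 2` (the two outermost layers at each face).

WHAT THIS MODULE PROVES (all in full; no `sorry`, standard axioms).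
* §1 `compField_eq_const_add_fluct` (`Ã = A₀ + A′` on `□`), `smul_compField` (`κÃ = (κA₀) + κA′` in the lineage's
  `constBond A₀ + A′` format).
* §2 **`regField_hyps`** — for `A′ := (e/n)·fluct □ (Ã(0)) Ã`: antisymmetry; the bond size `|A′_b| ≤ θ/n`,
  `θ = (d+1)S·c·e^β` (gen 6's `abs_fluct_le`, «c′ = dMc»); the derivative size `|A′(b′) − A′(b)| ≤ θ′/n²` on consecutive
  parallel bonds, `θ′ = c·e^β` ((1.7) itself, `fluct_step`); `A′ = 0` on both orientations of the bonds at the faces (the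
  collar constancy) — verbatim the binders `hanti′/hA′/hder/hbd` of the b2b Lemma-2.2 lineage at coupling `1`.
* §3 **`regField_threshold`** — «for e sufficiently small»: for `0 < e ≤ e₁(c, β, S)`, `θ(e) ≤ 1` and both smallness
  conditions of the lineage hold at `θ(e)`, `θ′(e)` for every running coefficient of the window `[¾a₋, a₊]`
  (`B4CubeFieldHyps22.cube_threshold` + `smallness_of_le`).
* §4 **`regField_pkg`** — the general-contour binders `hunit/hθ/hA′/hθ′/hder/hbd/hτ0/hτ` of
  `B4Lemma22EtaBox.lemma22_17_weighted_box_*` at `Ã` with the staircase block contours: invertibility for every field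
  (gen 4 `opA_stair_isUnit_det`), contour sums `τ = (d+1)θ` (`stair_lsum_le`).

HONEST SCOPE.  (i) Component fields on boxes with the lineage's staircase block contours; `A₀` is sampled at the box
corner `0` (any collar site gives the same value), so the bond size and hence `e₁` depend on the side bound `S`
(«c′ = dMc»: the print's `□` is a union of «few large blocks»).  (ii) The collar constancy is our READING of «constant in a
neighbourhood of the boundary» (two lattice layers suffice for the lineage's boundary binder `hbd`); the cube
configurations `Ã_j` of p. 575 satisfy it (`B4CubeFields22.thetaZ_eq_zero_of_face`).  Theorems only; no `def`, no
`Prop` fact, no `sorry`; axioms standard.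
-/

namespace Literature.MathematicalPhysics.QuantumFieldTheory.Balaban1983to89.B4RegFieldHyps22

open Finset Matrix
open Literature.MathematicalPhysics.QuantumFieldTheory.Balaban1983to89.B4GaugeCovariance
open Literature.MathematicalPhysics.QuantumFieldTheory.Balaban1983to89.B4Reflection242 (boxDom nbrs mem_boxDom mem_nbrs)
open Literature.MathematicalPhysics.QuantumFieldTheory.Balaban1983to89.B4Lower18Regular (e1 e1_apply_self e1_apply_ne
  baseEmb stairContour lsum)
open Literature.MathematicalPhysics.QuantumFieldTheory.Balaban1983to89.B4Lower18RegularRegion (compField)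
open Literature.MathematicalPhysics.QuantumFieldTheory.Balaban1983to89.B4Lemma22ReduceZero (Box opA)
open Literature.MathematicalPhysics.QuantumFieldTheory.Balaban1983to89.B4Lemma22SupStair (stair_lsum_le)
open Literature.MathematicalPhysics.QuantumFieldTheory.Balaban1983to89.B4Lemma22Invertible (opA_stair_isUnit_det)
open Literature.MathematicalPhysics.QuantumFieldTheory.Balaban1983to89.B4CubeFields22 (fluct fluct_step fluct_antisymm
  abs_fluct_le)
open Literature.MathematicalPhysics.QuantumFieldTheory.Balaban1983to89.B4CubeFieldHyps22 (cube_threshold smallness_of_le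
  constBond_smul)

noncomputable section

variable {d : ℕ}

/-! ## §1. `Ã = A₀ + A′` on `□`, and its charge scaling -/

section Field

/-- **`Ã = A₀ + A′`, `A₀ = Ã(0)`**: on any region the bond function of the component field `Ã` is the constant
configuration `Ã(0)` plus gen 6's fluctuation `fluct`. [cite: Balaban1983RegularityDecay, (2.23) p. 579 «A = A₀ + A′»] -/
theorem compField_eq_const_add_fluct (R : Finset (Fin (d + 1) → ℤ)) (Ac : (Fin (d + 1) → ℤ) → Fin (d + 1) → ℝ) :
    (fun u v : ↥R => compField Ac u.1 v.1) = constBond (Ac 0) Subtype.val + fluct R (Ac 0) Ac := by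
  funext u v
  simp only [Pi.add_apply, fluct, add_sub_cancel]

/-- `κÃ = (κA₀) + κA′` — the scaled field in the `A₀ + A′` format of the Lemma-2.2 lineage.
[cite: Balaban1983RegularityDecay, (2.23) p. 579, dictionary] -/
theorem smul_compField (R : Finset (Fin (d + 1) → ℤ)) (κ : ℝ) (Ac : (Fin (d + 1) → ℤ) → Fin (d + 1) → ℝ) :
    (fun u v : ↥R => κ * compField Ac u.1 v.1)
      = constBond (fun μ => κ * Ac 0 μ) Subtype.val + fun u v => κ * fluct R (Ac 0) Ac u v := by
  funext u v
  rw [Pi.add_apply, Pi.add_apply, ← constBond_smul, ← mul_add]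
  congr 1
  simp only [fluct, add_sub_cancel]

end Field

/-! ## §2. The field hypotheses of the Lemma-2.2 lineage at a general regular `Ã` constant on the collar -/

section Hyps

variable {N : Fin (d + 1) → ℕ}

/-- a box site whose backward `μ`-neighbour leaves the box sits on the low face: `x_μ = 0`. [folklore] -/
private theorem coord_eq_zero_of_sub_not_mem {x : Fin (d + 1) → ℤ} (hx : x ∈ boxDom N) {μ : Fin (d + 1)}
    (h : x - e1 μ ∉ boxDom N) : x μ = 0 := by
  by_contra hne
  apply h
  rw [mem_boxDom] at hx ⊢
  intro i
  by_cases hi : i = μ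
  · subst hi
    simp only [Pi.sub_apply, e1_apply_self]
    have := hx i
    omega
  · simp only [Pi.sub_apply, e1_apply_ne hi, sub_zero]
    exact hx i

/-- a box site `x` whose second forward `μ`-neighbour leaves the box sits next to the high face: `x_μ + 2 ≥ N_μ`.
[folklore] -/
private theorem coord_ge_of_add_add_not_mem {x : Fin (d + 1) → ℤ} (hx : x ∈ boxDom N) {μ : Fin (d + 1)}
    (h : x + e1 μ + e1 μ ∉ boxDom N) : (N μ : ℤ) ≤ x μ + 2 := by
  by_contra hne
  apply h
  rw [mem_boxDom] at hx ⊢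
  intro i
  by_cases hi : i = μ
  · subst hi
    simp only [Pi.add_apply, e1_apply_self]
    have := hx i
    omega
  · simp only [Pi.add_apply, e1_apply_ne hi, add_zero]
    exact hx i

/-- `e·e^{β−1} = e^β`. [folklore] -/
private theorem mul_rpow_sub_one {e : ℝ} (he : 0 < e) (β : ℝ) : e * e ^ (β - 1) = e ^ β := by
  rw [Real.rpow_sub_one he.ne', mul_div_cancel₀ _ he.ne']

/-- **THE FIELD HYPOTHESES OF THE LEMMA-2.2 LINEAGE AT A GENERAL REGULAR `Ã` CONSTANT ON THE COLLAR, PROVED FROM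
(1.7).**  Box `□ = Π_μ[0, nM_μ)`, `n = L^k`, sides `M_μ ≤ S`; the component field `Ã` (1.7)-regular on `□` with constants
`c, β` and equal to `Ã(0)` at every collar site (`x_μ = 0` or `x_μ + 2 ≥ nM_μ` for some `μ`); charge `e > 0`.  Then the
scaled fluctuation `A′ = (e/n)·(Ã − Ã(0))` (so that `(e/n)Ã = (e/n)A₀ + A′`) is antisymmetric, has `|A′_b| ≤ θ/n` on
nearest-neighbour bonds with `θ = (d+1)S·c·e^β`, `|A′(b′) − A′(b)| ≤ θ′/n²` on consecutive parallel bonds with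
`θ′ = c·e^β`, and vanishes on the bonds at the faces — the binders `hanti′/hA′/hder/hbd` of the lineage at coupling `1`.
[cite: Balaban1983RegularityDecay, Lemma 2.2 p. 577 with (2.23) p. 579 «|A′|, |∂^η_μA′| ≤ c′e^{β−1}» and (1.7) p. 573] -/
theorem regField_hyps {ℓ k : ℕ} (hn : 1 ≤ (ℓ + 1) ^ k) {M : Fin (d + 1) → ℕ} (hM : ∀ i, 1 ≤ M i) {S : ℕ}
    (hS : ∀ i, M i ≤ S) {Ac : (Fin (d + 1) → ℤ) → Fin (d + 1) → ℝ} {creg β e : ℝ} (hcreg : 0 ≤ creg) (he : 0 < e)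
    (h17 : ∀ x ∈ Box d ℓ k M, ∀ μ ν : Fin (d + 1),
      |Ac (x + e1 μ) ν - Ac x ν| ≤ creg * e ^ (β - 1) / ((ℓ + 1) ^ k : ℕ))
    (hcol : ∀ x ∈ Box d ℓ k M, ∀ μ : Fin (d + 1),
      (x μ = 0 ∨ (((ℓ + 1) ^ k * M μ : ℕ) : ℤ) ≤ x μ + 2) → ∀ ν, Ac x ν = Ac 0 ν) :
    let A' : ↥(Box d ℓ k M) → ↥(Box d ℓ k M) → ℝ :=
      fun u v => e / ((ℓ + 1) ^ k : ℕ) * fluct (Box d ℓ k M) (Ac 0) Ac u v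
    (∀ x y, A' y x = -A' x y) ∧
    (∀ x y : ↥(Box d ℓ k M), y.1 ∈ nbrs x.1 →
      |1 * A' x y| ≤ ((d : ℝ) + 1) * S * creg * e ^ β / ((ℓ + 1) ^ k : ℕ)) ∧
    (∀ (x z y : ↥(Box d ℓ k M)) (μ : Fin (d + 1)), z.1 = x.1 + e1 μ → y.1 = z.1 + e1 μ →
      |1 * (A' y z - A' z x)| ≤ creg * e ^ β / (((ℓ + 1) ^ k : ℕ) : ℝ) ^ 2 ∧
      |1 * (A' x z - A' z y)| ≤ creg * e ^ β / (((ℓ + 1) ^ k : ℕ) : ℝ) ^ 2) ∧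
    (∀ (x y : ↥(Box d ℓ k M)) (μ : Fin (d + 1)), y.1 = x.1 + e1 μ →
      (x.1 - e1 μ ∉ Box d ℓ k M ∨ y.1 + e1 μ ∉ Box d ℓ k M) → A' x y = 0 ∧ A' y x = 0) := by
  intro A'
  set n : ℕ := (ℓ + 1) ^ k with hn_def
  have hnr : (0 : ℝ) < n := by exact_mod_cast hn
  have hN : ∀ i, 1 ≤ n * M i := fun i => le_trans hn (Nat.le_mul_of_pos_right _ (hM i))
  have hT : ∀ i, ((n * M i : ℕ) : ℤ) ≤ (n : ℤ) * S := fun i => by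
    push_cast; exact mul_le_mul_of_nonneg_left (by exact_mod_cast hS i) (by positivity)
  have hδ : 0 ≤ creg * e ^ (β - 1) / (n : ℕ) := by positivity
  refine ⟨fun x y => ?_, fun x y hxy => ?_, fun x z y μ hz hy => ?_, fun x y μ hy hface => ?_⟩
  · -- antisymmetry
    show e / (n : ℕ) * _ = -(e / (n : ℕ) * _)
    rw [fluct_antisymm]; ring
  · -- the bond size «|A′| ≤ c′e^{β−1}», c′ = (d+1)·S·c
    show |1 * (e / (n : ℕ) * fluct (Box d ℓ k M) (Ac 0) Ac x y)| ≤ _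
    have hb := abs_fluct_le hN hT hδ h17 x y hxy
    rw [one_mul, abs_mul, abs_of_pos (by positivity : (0 : ℝ) < e / (n : ℕ))]
    calc e / (n : ℕ) * |fluct (Box d ℓ k M) (Ac 0) Ac x y|
        ≤ e / (n : ℕ) * (((d : ℝ) + 1) * ((n : ℤ) * S : ℤ) * (creg * e ^ (β - 1) / (n : ℕ))) :=
          mul_le_mul_of_nonneg_left hb (by positivity)
      _ = ((d : ℝ) + 1) * S * creg * (e * e ^ (β - 1)) / (n : ℕ) := by
          push_cast; field_simp
      _ = ((d : ℝ) + 1) * S * creg * e ^ β / (n : ℕ) := by rw [mul_rpow_sub_one he]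
  · -- the derivative member: `A′(y,z) − A′(z,x) = −(e/n)(Ã_μ(x + e_μ) − Ã_μ(x))`
    have h1 : A' z y = e / (n : ℕ) * (Ac z.1 μ - Ac 0 μ) := by
      show e / (n : ℕ) * fluct (Box d ℓ k M) (Ac 0) Ac z y = _
      rw [fluct_step (Ac 0) Ac hy]
    have h2 : A' x z = e / (n : ℕ) * (Ac x.1 μ - Ac 0 μ) := by
      show e / (n : ℕ) * fluct (Box d ℓ k M) (Ac 0) Ac x z = _
      rw [fluct_step (Ac 0) Ac hz]
    have h3 : A' y z = -A' z y := by
      show e / (n : ℕ) * _ = -(e / (n : ℕ) * _)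
      rw [fluct_antisymm]; ring
    have h4 : A' z x = -A' x z := by
      show e / (n : ℕ) * _ = -(e / (n : ℕ) * _)
      rw [fluct_antisymm]; ring
    have hreg : |Ac z.1 μ - Ac x.1 μ| ≤ creg * e ^ (β - 1) / (n : ℕ) := by
      rw [hz]; exact h17 x.1 x.2 μ μ
    have key : |e / (n : ℕ) * (Ac z.1 μ - Ac x.1 μ)| ≤ creg * e ^ β / ((n : ℕ) : ℝ) ^ 2 := by
      rw [abs_mul, abs_of_pos (by positivity : (0 : ℝ) < e / (n : ℕ))]
      calc e / (n : ℕ) * |Ac z.1 μ - Ac x.1 μ| ≤ e / (n : ℕ) * (creg * e ^ (β - 1) / (n : ℕ)) :=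
            mul_le_mul_of_nonneg_left hreg (by positivity)
        _ = creg * (e * e ^ (β - 1)) / ((n : ℕ) : ℝ) ^ 2 := by field_simp
        _ = _ := by rw [mul_rpow_sub_one he]
    constructor
    · rw [one_mul, h3, h4, h1, h2, show -(e / (n : ℕ) * (Ac z.1 μ - Ac 0 μ)) - -(e / (n : ℕ) * (Ac x.1 μ - Ac 0 μ))
        = -(e / (n : ℕ) * (Ac z.1 μ - Ac x.1 μ)) by ring, abs_neg]
      exact key
    · rw [one_mul, h1, h2, show e / (n : ℕ) * (Ac x.1 μ - Ac 0 μ) - e / (n : ℕ) * (Ac z.1 μ - Ac 0 μ)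
        = -(e / (n : ℕ) * (Ac z.1 μ - Ac x.1 μ)) by ring, abs_neg]
      exact key
  · -- vanishing at the faces, from the collar constancy
    have hxμ : x.1 μ = 0 ∨ (((n * M μ : ℕ)) : ℤ) ≤ x.1 μ + 2 := by
      rcases hface with h | h
      · exact Or.inl (coord_eq_zero_of_sub_not_mem x.2 h)
      · rw [hy] at h
        exact Or.inr (coord_ge_of_add_add_not_mem x.2 h)
    have h0 : A' x y = 0 := by
      show e / (n : ℕ) * fluct (Box d ℓ k M) (Ac 0) Ac x y = 0
      rw [fluct_step (Ac 0) Ac hy, hcol x.1 x.2 μ hxμ μ, sub_self, mul_zero]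
    refine ⟨h0, ?_⟩
    show e / (n : ℕ) * fluct (Box d ℓ k M) (Ac 0) Ac y x = 0
    rw [fluct_antisymm, mul_neg]
    exact neg_eq_zero.2 h0

end Hyps

/-! ## §3. «For e sufficiently small» at a general regular field -/

section Threshold

/-- **«FOR e SUFFICIENTLY SMALL» AT A GENERAL REGULAR FIELD** — the common threshold of the pay-off theorems of
`B4Lemma22RegField` / `B4Lemma22RegFieldDual` (for the Lemma-2.2 constant `c` of the member at hand): for
`0 < e ≤ e₁(c, β, S)`, `θ(e) = (d+1)S·c·e^β ≤ 1` and both smallness conditions of the lineage hold at `θ(e)`,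
`θ′(e) = c·e^β`, for every `a_k` of the window `[¾a₋, a₊]`.
[cite: Balaban1983RegularityDecay, Lemma 2.2 p. 577 «for e sufficiently small», p. 581] -/
theorem regField_threshold (d : ℕ) {ℓ₁ c amin aplus creg β : ℝ} (hℓ₁ : 0 ≤ ℓ₁) (hc : 0 ≤ c) (ha : 0 < amin)
    (hcreg : 0 ≤ creg) (hβ : 0 < β) (S : ℕ) :
    ∃ e₁ : ℝ, 0 < e₁ ∧ ∀ e : ℝ, 0 < e → e ≤ e₁ → ∀ ak : ℝ, 3 / 4 * amin ≤ ak → ak ≤ aplus →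
      ((d : ℝ) + 1) * S * creg * e ^ β ≤ 1 ∧
      ℓ₁ ^ 2 * (((d : ℝ) + 1) * S * creg * e ^ β) ^ 2 * ((d : ℝ) + 1) * (1 + ak * ((d : ℝ) + 1)) ≤ min 2 ak / 4 ∧
      ((d : ℝ) + 2) * c * (((d : ℝ) + 1) * ℓ₁ * (((d : ℝ) + 1) * S * creg * e ^ β + creg * e ^ β)
        + ((d : ℝ) + 1) * ℓ₁ * (((d : ℝ) + 1) * S * creg * e ^ β)
        + ((d : ℝ) + 1) * ℓ₁ ^ 2 * (((d : ℝ) + 1) * S * creg * e ^ β) ^ 2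
        + ak * (ℓ₁ * (((d : ℝ) + 1) * (((d : ℝ) + 1) * S * creg * e ^ β))
          * (2 + ℓ₁ * (((d : ℝ) + 1) * (((d : ℝ) + 1) * S * creg * e ^ β))))) ≤ 1 / 2 := by
  set t : ℝ := min 1 (min (min 2 (3 / 4 * amin) / 4 / (ℓ₁ ^ 2 * ((d : ℝ) + 1) * (1 + aplus * ((d : ℝ) + 1)) + 1))
    (1 / (2 * (((d : ℝ) + 2) * c) * (3 * ((d : ℝ) + 1) * ℓ₁ + ((d : ℝ) + 1) * ℓ₁ ^ 2
      + aplus * (ℓ₁ * ((d : ℝ) + 1)) * (2 + ℓ₁ * ((d : ℝ) + 1))) + 1))) with ht_def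
  by_cases hapl : aplus < 3 / 4 * amin
  · refine ⟨1, one_pos, fun e _ _ ak hak1 hak2 => absurd (hak1.trans hak2) (not_le.2 hapl)⟩
  rw [not_lt] at hapl
  have hapl0 : 0 ≤ aplus := by linarith
  have ht0 : 0 < t := by
    rw [ht_def]
    refine lt_min one_pos (lt_min ?_ ?_)
    · exact div_pos (div_pos (lt_min two_pos (by linarith)) four_pos) (by positivity)
    · exact div_pos one_pos (by positivity)
  obtain ⟨e₁, he₁, hth⟩ := cube_threshold (C := ((d : ℝ) + 1) * S * creg) (C' := creg) (by positivity) ht0 hβ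
  refine ⟨e₁, he₁, fun e he hle ak hak1 hak2 => ?_⟩
  obtain ⟨hθt, hθ't⟩ := hth e he hle
  have hθ0 : 0 ≤ ((d : ℝ) + 1) * S * creg * e ^ β := by
    have := (Real.rpow_pos_of_pos he β).le; positivity
  have ht1 : t ≤ 1 := by rw [ht_def]; exact min_le_left _ _
  have htS1 : t ≤ min 2 (3 / 4 * amin) / 4 / (ℓ₁ ^ 2 * ((d : ℝ) + 1) * (1 + aplus * ((d : ℝ) + 1)) + 1) := by
    rw [ht_def]; exact (min_le_right _ _).trans (min_le_left _ _)
  have htS2 : t ≤ 1 / (2 * (((d : ℝ) + 2) * c) * (3 * ((d : ℝ) + 1) * ℓ₁ + ((d : ℝ) + 1) * ℓ₁ ^ 2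
      + aplus * (ℓ₁ * ((d : ℝ) + 1)) * (2 + ℓ₁ * ((d : ℝ) + 1))) + 1) := by
    rw [ht_def]; exact (min_le_right _ _).trans (min_le_right _ _)
  exact ⟨hθt.trans ht1, smallness_of_le d hℓ₁ hc ha hak1 hak2 hθ0 hθt hθ't ht1 htS1 htS2⟩

end Threshold

/-! ## §4. The general-contour package at `Ã` with the staircase block contours -/

section Package

variable {ι : Type} [Fintype ι] [DecidableEq ι]

/-- **THE GENERAL-CONTOUR BINDERS OF THE LEMMA-2.2 LINEAGE AT A GENERAL REGULAR `Ã` CONSTANT ON THE COLLAR, ALL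
DISCHARGED**: for the box `□` with the staircase block contours, `Ã` (1.7)-regular with `(c, β)` and constant on the
collar, `0 < e`, and the scaled parts `A₀′ = (e/n)Ã(0)`, `A′ = (e/n)(Ã − Ã(0))`: invertibility of `H_k(□, A₀′ + A′)` at
charge `1` (gen 4), the bond size `θ = (d+1)S·c·e^β`, the derivative size `θ′ = c·e^β`, vanishing at the faces (§2), and
the staircase contour sums `τ = (d+1)θ` (`stair_lsum_le`) — exactly the binders `hunit/hθ/hA′/hθ′/hder/hbd/hτ0/hτ` of
`B4Lemma22EtaBox.lemma22_17_weighted_box_sup/…_dual/…_dual_one/…_dual_sup` and of `B4Lemma22HolderBox`.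
[cite: Balaban1983RegularityDecay, Lemma 2.2 p. 577 with (2.23) p. 579 and (1.7) p. 573] -/
theorem regField_pkg (F : OrthFlow ι) {ℓ k : ℕ} (hℓ : 1 ≤ ℓ) (hk : 1 ≤ k) (hn : 1 ≤ (ℓ + 1) ^ k)
    {a m2 : ℝ} (ha : 0 < a) (hm : 0 ≤ m2) {M : Fin (d + 1) → ℕ} (hM : ∀ i, 1 ≤ M i) {S : ℕ} (hS : ∀ i, M i ≤ S)
    {Ac : (Fin (d + 1) → ℤ) → Fin (d + 1) → ℝ} {creg β e : ℝ} (hcreg : 0 ≤ creg) (he : 0 < e)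
    (h17 : ∀ x ∈ Box d ℓ k M, ∀ μ ν : Fin (d + 1),
      |Ac (x + e1 μ) ν - Ac x ν| ≤ creg * e ^ (β - 1) / ((ℓ + 1) ^ k : ℕ))
    (hcol : ∀ x ∈ Box d ℓ k M, ∀ μ : Fin (d + 1),
      (x μ = 0 ∨ (((ℓ + 1) ^ k * M μ : ℕ) : ℤ) ≤ x μ + 2) → ∀ ν, Ac x ν = Ac 0 ν) :
    let A' : ↥(Box d ℓ k M) → ↥(Box d ℓ k M) → ℝ :=
      fun u v => e / ((ℓ + 1) ^ k : ℕ) * fluct (Box d ℓ k M) (Ac 0) Ac u v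
    let A₀' : Fin (d + 1) → ℝ := fun ν => e / ((ℓ + 1) ^ k : ℕ) * Ac 0 ν
    let θ : ℝ := ((d : ℝ) + 1) * S * creg * e ^ β
    let θ' : ℝ := creg * e ^ β
    (∀ x y, A' y x = -A' x y) ∧
    IsUnit (opA d F 1 ℓ k a m2 M (baseEmb hn M) (stairContour hn M) (constBond A₀' Subtype.val + A')).det ∧
    0 ≤ θ ∧ (∀ x y : ↥(Box d ℓ k M), y.1 ∈ nbrs x.1 → |1 * A' x y| ≤ θ / ((ℓ + 1) ^ k : ℕ)) ∧
    0 ≤ θ' ∧ (∀ (x z y : ↥(Box d ℓ k M)) (μ : Fin (d + 1)), z.1 = x.1 + e1 μ → y.1 = z.1 + e1 μ →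
      |1 * (A' y z - A' z x)| ≤ θ' / (((ℓ + 1) ^ k : ℕ) : ℝ) ^ 2 ∧
      |1 * (A' x z - A' z y)| ≤ θ' / (((ℓ + 1) ^ k : ℕ) : ℝ) ^ 2) ∧
    (∀ (x y : ↥(Box d ℓ k M)) (μ : Fin (d + 1)), y.1 = x.1 + e1 μ →
      (x.1 - e1 μ ∉ Box d ℓ k M ∨ y.1 + e1 μ ∉ Box d ℓ k M) → A' x y = 0 ∧ A' y x = 0) ∧
    0 ≤ ((d : ℝ) + 1) * θ ∧
    (∀ y x, blkWt ((ℓ + 1) ^ k) M (fun i => (ℓ + 1) ^ k * M i) y x ≠ 0 →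
      |1 * lsum A' (baseEmb hn M y) (stairContour hn M y x)| ≤ ((d : ℝ) + 1) * θ) := by
  intro A' A₀' θ θ'
  obtain ⟨hanti', hA', hder, hbd⟩ := regField_hyps (d := d) hn hM hS hcreg he h17 hcol (β := β)
  have heβ : 0 ≤ e ^ β := (Real.rpow_pos_of_pos he β).le
  have hθ0 : 0 ≤ θ := by positivity
  have hθ'0 : 0 ≤ θ' := by positivity
  refine ⟨hanti', opA_stair_isUnit_det F 1 hℓ hk hn ha hm M _, hθ0, hA', hθ'0, hder, hbd, by positivity, ?_⟩
  intro y x _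
  exact stair_lsum_le 1 hn M hθ0 hA' y x

end Package

end

end Literature.MathematicalPhysics.QuantumFieldTheory.Balaban1983to89.B4RegFieldHyps22
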